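import Literature.Geometry.Riemannian.SimpleAHBoundarySphere
import Literature.Geometry.Riemannian.AHCompleteness
import Literature.Geometry.Riemannian.AHConvexNearInfinity
import Literature.Geometry.Riemannian.AHExitStructure
import Literature.Geometry.Riemannian.StarLiftInjective
import Literature.Geometry.Riemannian.CartanHadamardCovering
import Literature.Topology.FourManifolds.BoundaryFlowout
import Literature.Topology.FourManifolds.RegularSlabField
import Mathlib.Geometry.Manifold.Instances.Sphere
import HarnessLib

/-!
# The boundary at infinity of a non-trapping asymptotically hyperbolic manifold with `K ≤ 0` is a
# sphere: discharge of `ggsu_boundary_sphere_of_nonTrapping_of_nonpos` (GGSU 2019, Prop. 5.13, cor.)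

This file proves the named fact
`Literature.Geometry.Riemannian.ggsu_boundary_sphere_of_nonTrapping_of_nonpos` of
`SimpleAHBoundarySphere.lean` (C. R. Graham, C. Guillarmou, P. Stefanov, G. Uhlmann, *X-ray
transform and boundary rigidity for asymptotically hyperbolic manifolds*, Ann. Inst. Fourier 69
(2019), Prop. 5.13 with the remark after Def. 5.3: for a simple AH manifold the rays from an
interior point `p` identify the unit sphere `S_pM` with `∂M̄`).

## Proof (the level-set route; see the support files)

For the AH manifold `(N, g)` with compactification `j : N ≅ int X`, `ι : B ≅ ∂X`, boundary defining
function `ρ` and `j^* ḡ = (ρ ∘ j)² g`: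
1. `K ≤ 0` on orthonormal pairs gives `Rm(X,Y,Y,X) ≤ 0` (`AHCompleteness.lean`), and `g` is complete
   (ibid., Gordon's criterion with `-log (ρ ∘ j)`); hence by the tree's Cartan–Hadamard layers
   `exp_p : T_pN → N` is a smooth surjective covering map and a local diffeomorphism.
2. Convexity near infinity (`AHConvexNearInfinity.lean`): `ρ ∘ j` has no interior minimum below
   `ε₀` along geodesics; so (`AHExitStructure.lean`) each unit ray from `p` crosses a small level
   `{ρ ∘ j = ε}` exactly once, transversally, the crossing time `τ` is smooth, and
   `exp_p⁻¹{ρ ∘ j ≥ ε}` is a star-shaped closed ball `K`.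
3. `K` is saturated, so `exp_p` is injective (`StarLiftInjective.lean`: Brouwer + homotopy lifting),
   hence a diffeomorphism `T_pN ≅ N`.
4. The collar of `∂X` along a vector field `ξ` with `ξ(ρ) = 1` (the tree's Milnor flow-out,
   `BoundaryFlowout.lean`) identifies `B` with the level `{ρ = ε}`; composing, the radial map
   `ω ↦ ι⁻¹(proj(j(exp_p(τ ω))))` is a diffeomorphism from the unit sphere of `T_pN` onto `B`.

No new definitions or named facts (D-0026).

## References

* C. R. Graham, C. Guillarmou, P. Stefanov, G. Uhlmann, Ann. Inst. Fourier 69 (2019) 2857–2919,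
  doi:10.5802/aif.3339, arXiv:1709.05053: p. 3, p. 10 (Lemma 2.4 and the remark after it),
  Def. 5.3 and remark (p. 27), Prop. 5.11 (p. 28), §5.1 and Prop. 5.13 (p. 30). [GrahamEtAl2020]
* J. M. Lee, *Introduction to Riemannian Manifolds* (2018), Thm. 12.8. [Lee2018]
* J. Milnor, *Lectures on the h-cobordism theorem* (1965), proof of Thm. 3.4. [MilnorHCobordism1965]
-/

noncomputable section

open Bundle Set Filter Function Metric TopologicalSpace
open scoped Manifold ContDiff Topology

namespace Literature.Geometry.Riemannian

namespace SimpleAH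

open Literature.Geometry.Lorentzian
open Literature.Geometry.Lorentzian.PseudoRiemannianMetric

set_option maxSynthPendingDepth 3



/-! ### Cartan–Hadamard for complete manifolds: `exp_p` is a smooth bijection-ready covering -/

section CartanHadamardComplete

variable {E : Type*} [NormedAddCommGroup E] [NormedSpace ℝ E] {H : Type*} [TopologicalSpace H]
  {I : ModelWithCorners ℝ E H} {M : Type*} [TopologicalSpace M] [ChartedSpace H M]
  [IsManifold I ∞ M] [FiniteDimensional ℝ E] [CompleteSpace E] [T2Space M] [I.Boundaryless]
  [ConnectedSpace M]
  {g : PseudoRiemannianMetric I ∞ E (TangentSpace I : M → Type _)} [g.HasLeviCivita]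
  [CovariantDerivative.ContMDiffCovariantDerivative g.leviCivita 1]
  [CovariantDerivative.ContMDiffCovariantDerivative g.leviCivita ∞]

/-- **Cartan–Hadamard, complete form** (Lee 2018, Thm. 12.8; the assembly of the tree's layers
`CartanHadamard.isLocalDiffeomorph_expMap`, `isGeodesicallyComplete_comap_expMap` and
`surjective_and_isCoveringMap_of_isGeodesicallyComplete`, as in the discharge of
`Lee2018_cartanHadamard_compact` but with completeness as a hypothesis instead of compactness):
on a connected complete Riemannian manifold with `Rm(X, Y, Y, X) ≤ 0`, `exp_p : T_pM → M` is a
smooth surjective covering map and a local diffeomorphism. [cite: Lee2018, Thm. 12.8] -/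
theorem exp_covering_of_complete (hg : g.IsRiemannian) (hc : IsGeodesicallyComplete g.leviCivita)
    (hsec : ∀ (x : M) (X Y : TangentSpace I x), g.curvatureForm g.leviCivita x X Y Y X ≤ 0)
    (p : M) :
    ContMDiff 𝓘(ℝ, E) I ∞ (fun u : E ↦ expMap g.leviCivita p (show TangentSpace I p from u)) ∧
    IsLocalDiffeomorph 𝓘(ℝ, E) I ∞ (fun u : E ↦ expMap g.leviCivita p (show TangentSpace I p from u)) ∧
    Surjective (fun u : E ↦ expMap g.leviCivita p (show TangentSpace I p from u)) ∧
    IsCoveringMap (fun u : E ↦ expMap g.leviCivita p (show TangentSpace I p from u)) := by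
  have hk1 : ((1 : ℕ∞) : ℕ∞ω) + 1 ≤ ∞ := by
    rw [show ((1 : ℕ∞) : ℕ∞ω) + 1 = 2 by norm_num]
    exact WithTop.coe_le_coe.2 le_top
  have hktop : ((⊤ : ℕ∞) : ℕ∞ω) + 1 ≤ ∞ := le_of_eq rfl
  have hcov₁ : g.leviCivita.IsLocallyContMDiff 1 := g.isLocallyContMDiff_leviCivita_holds 1 hk1
  set F : E → M := fun u ↦ expMap g.leviCivita p (show TangentSpace I p from u) with hFdef
  have hinj : ∀ v, Injective (mfderiv 𝓘(ℝ, E) I F v) :=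
    CartanHadamard.mfderiv_expMap_injective (I := I) hg hsec hcov₁ hc p
  have hlocal : IsLocalDiffeomorph 𝓘(ℝ, E) I ∞ F :=
    CartanHadamard.isLocalDiffeomorph_expMap (I := I) hg hsec hcov₁ hc p
  have hF : ContMDiff 𝓘(ℝ, E) I (∞ + 1) F := contMDiff_expMap_infty (I := I) hc p
  have hpb : contMDiff_pullbackBilin I M 𝓘(ℝ, E) E ∞ := contMDiff_pullbackBilin_holds
  set gt := g.comap hpb F hF hinj rfl with hgt
  haveI hLCt : gt.HasLeviCivita := gt.hasLeviCivita
  haveI : CovariantDerivative.ContMDiffCovariantDerivative gt.leviCivita 1 :=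
    ⟨gt.isLocallyContMDiff_leviCivita_holds 1 hk1 univ isOpen_univ⟩
  haveI : CovariantDerivative.ContMDiffCovariantDerivative gt.leviCivita ∞ :=
    ⟨gt.isLocallyContMDiff_leviCivita_holds ⊤ hktop univ isOpen_univ⟩
  have hcN : IsGeodesicallyComplete gt.leviCivita :=
    CartanHadamard.isGeodesicallyComplete_comap_expMap (I := I) hg hc p hinj hF hpb
  haveI : Nonempty E := ⟨0⟩
  have hcov := CartanHadamard.surjective_and_isCoveringMap_of_isGeodesicallyComplete
    (g := g) (f := F) (hpb := hpb) (hf := hF) (hf' := hinj) (hdim := rfl) hcN hc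
  exact ⟨hF.of_le le_self_add, hlocal, hcov.1, hcov.2⟩

end CartanHadamardComplete

/-! ### The open collar of the boundary along a boundary defining function -/

section Collar

open Literature.Topology.FourManifolds

variable {m : ℕ} {X : Type} [TopologicalSpace X] [T2Space X] [CompactSpace X]
  [ChartedSpace (EuclideanHalfSpace (m + 2)) X] [IsManifold (𝓡∂ (m + 2)) ∞ X]

/-- **The open collar of `∂X` cut out by the levels of a boundary defining function** (Milnor 1965,
proof of Thm. 3.4, through the tree's `FlowoutInput`/`Cover.openCollarData` of
`BoundaryFlowout.lean`): for a compact manifold with boundary `X` of dimension `≥ 2`, a boundary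
datum `b`, and a smooth `ρ ≥ 0` vanishing exactly on `∂X` with `dρ ≠ 0` there, there is an open
collar `c : b.OpenCollarData` whose height function is `2ρ/a` on the region `{ρ < a}`, `a > 0`
(the flow-out along a vector field `ξ` with `ξ(ρ) = 1` near `∂X`).
[cite: MilnorHCobordism1965, proof of Thm. 3.4] -/
theorem exists_openCollarData_of_bdf (b : BoundaryData (𝓡∂ (m + 2)) X (𝓡 (m + 1)))
    [Nonempty b.carrier] {ρ : X → ℝ} (hρs : ContMDiff (𝓡∂ (m + 2)) 𝓘(ℝ, ℝ) ∞ ρ)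
    (hρ0 : ∀ z, 0 ≤ ρ z) (hρb : ∀ z, ρ z = 0 ↔ z ∈ (𝓡∂ (m + 2)).boundary X)
    (hreg : ∀ z, ρ z = 0 → mfderiv (𝓡∂ (m + 2)) 𝓘(ℝ, ℝ) ρ z ≠ 0) :
    ∃ (a : ℝ) (c : b.OpenCollarData), 0 < a ∧ c.region = {z | ρ z < a} ∧ c.top = 2 ∧
      ∀ z, c.height z = ρ z * (2 / a) := by
  obtain ⟨δ', hδ', hδ'reg⟩ := exists_pos_forall_mfderiv_ne_zero hρs hρ0 hreg
  set δ := δ' / 2 with hδ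
  have hδpos : 0 < δ := by positivity
  have hreg2 : ∀ z ∈ {z : X | ρ z ≤ δ}, mfderiv (𝓡∂ (m + 2)) 𝓘(ℝ, ℝ) ρ z ≠ 0 := fun z hz ↦
    hδ'reg z (by simp only [mem_setOf_eq] at hz; linarith)
  obtain ⟨ξ, hξ⟩ := exists_contMDiffSection_mlineDeriv_eq_one_on hρs
    (isClosed_le hρs.continuous continuous_const) hreg2
  set D : FlowoutInput (m + 1) X :=
    ⟨ρ, ξ, δ, hδpos, hρs, hρ0, hρb, ξ.contMDiff, fun z hz ↦ hξ z hz⟩ with hD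
  obtain ⟨Γ⟩ := D.nonempty_cover
  exact ⟨Γ.a, Γ.openCollarData b, Γ.a_pos, rfl, rfl, fun z ↦ rfl⟩

end Collar

/-! ### Radial smoothness on `T_pN` -/

section Radial

variable {E : Type*} [NormedAddCommGroup E] [InnerProductSpace ℝ E]

omit [InnerProductSpace ℝ E] in
/-- The `B`-normalization `w ↦ w / √B(w,w)` of a positive definite form is `C^∞` away from `0`.
[folklore] -/
theorem contDiffOn_formNormalize [NormedSpace ℝ E] (B : E →L[ℝ] E →L[ℝ] ℝ)
    (hpos : ∀ w : E, w ≠ 0 → 0 < B w w) :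
    ContDiffOn ℝ ∞ (fun w : E ↦ (Real.sqrt (B w w))⁻¹ • w) {w | w ≠ 0} := by
  intro w hw
  have h1 : ContDiffAt ℝ ∞ (fun w : E ↦ B w w) w := (B.contDiff.clm_apply contDiff_id).contDiffAt
  have h2 : ContDiffAt ℝ ∞ (fun w : E ↦ Real.sqrt (B w w)) w := h1.sqrt (hpos w hw).ne'
  have h3 : ContDiffAt ℝ ∞ (fun w : E ↦ (Real.sqrt (B w w))⁻¹) w :=
    h2.inv (Real.sqrt_pos.2 (hpos w hw)).ne'
  exact (h3.smul contDiffAt_id).contDiffWithinAt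

/-- The Euclidean normalization `w ↦ w / ‖w‖` is `C^∞` away from `0`. [folklore] -/
theorem contDiffOn_normalize :
    ContDiffOn ℝ ∞ (fun w : E ↦ ‖w‖⁻¹ • w) {w | w ≠ 0} := by
  intro w hw
  have h1 : ContDiffAt ℝ ∞ (fun w : E ↦ ‖w‖) w := contDiffAt_norm ℝ hw
  exact ((h1.inv (norm_ne_zero_iff.2 hw)).smul contDiffAt_id).contDiffWithinAt

end Radial

end SimpleAH

open SimpleAH Literature.Geometry.Lorentzian Literature.Geometry.Lorentzian.PseudoRiemannianMetric
  Literature.Topology.FourManifolds in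
set_option maxSynthPendingDepth 3 in
set_option maxHeartbeats 800000 in
/-- **Discharge of `ggsu_boundary_sphere_of_nonTrapping_of_nonpos`** (GGSU 2019, corollary of
Prop. 5.13 with the remark after Def. 5.3): the boundary at infinity `B ≅ ∂X` of a non-trapping
asymptotically hyperbolic manifold with non-positive sectional curvature (smooth compactification
`X`, `dim = n + 1`, `n ≥ 1`) is diffeomorphic to `Sⁿ`. Proof along the module docstring: complete
(`AHCompleteness`), Cartan–Hadamard covering by `exp_p`, convexity near infinity and the exit
structure of the rays from `p` (`AHConvexNearInfinity`, `AHExitStructure`), injectivity of `exp_p`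
by the saturated star-shaped ball (`StarLiftInjective`), and Milnor's collar of `∂X` along the
boundary defining function; the diffeomorphism is `ω ↦ ι⁻¹(proj(j(exp_p(τ(ω) ω))))`.
[cite: GrahamEtAl2020, Prop. 5.13 (p. 30), Def. 5.3 and remark (p. 27), p. 10] -/
theorem ggsu_boundary_sphere_of_nonTrapping_of_nonpos_holds :
    ggsu_boundary_sphere_of_nonTrapping_of_nonpos := by
  intro n hn B _ _ _ _ _ _ N _ _ _ _ _ _ g _ hAH hNT hsec
  obtain ⟨m, rfl⟩ : ∃ m, n = m + 1 := ⟨n - 1, by omega⟩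
  obtain ⟨X, _, _, _, _, _, _, _, j, ι, ρ, gb, hj, hjr, hι, hιr, hρs, hρ0, hρb, hν, hconf⟩ := hAH
  -- the metrics as pseudo-Riemannian metrics of the tree
  set G := PseudoRiemannianMetric.ofRiemannian g with hGdef
  have hGr : G.IsRiemannian := isRiemannian_ofRiemannian g
  set Gb := PseudoRiemannianMetric.ofRiemannian gb with hGbdef
  have hGbr : Gb.IsRiemannian := isRiemannian_ofRiemannian gb
  have hk1 : ((1 : ℕ∞) : ℕ∞ω) + 1 ≤ ∞ := by
    rw [show ((1 : ℕ∞) : ℕ∞ω) + 1 = 2 by norm_num]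
    exact WithTop.coe_le_coe.2 le_top
  have hktop : ((⊤ : ℕ∞) : ℕ∞ω) + 1 ≤ ∞ := le_of_eq rfl
  have h2 : (2 : ℕ∞ω) ≤ ∞ := WithTop.coe_le_coe.2 le_top
  haveI : CovariantDerivative.ContMDiffCovariantDerivative G.leviCivita 1 :=
    ⟨G.isLocallyContMDiff_leviCivita_holds 1 hk1 univ isOpen_univ⟩
  haveI : CovariantDerivative.ContMDiffCovariantDerivative G.leviCivita ∞ :=
    ⟨G.isLocallyContMDiff_leviCivita_holds ⊤ hktop univ isOpen_univ⟩
  -- (1) sectional curvature on all pairs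
  have hsec' : ∀ (x : N) (X Y : TangentSpace (𝓡 (m + 1 + 1)) x),
      G.curvatureForm G.leviCivita x X Y Y X ≤ 0 :=
    curvatureForm_leviCivita_nonpos_of_orthonormal h2 hGr
      (fun x X Y hX hY hXY ↦ hsec x X Y hX hY hXY)
  -- (2) completeness
  have hconf₁ : ∀ (x : N) (v : TangentSpace (𝓡 (m + 1 + 1)) x),
      Gb.val (j x) (mfderiv (𝓡 (m + 1 + 1)) (𝓡∂ (m + 1 + 1)) j x v)
        (mfderiv (𝓡 (m + 1 + 1)) (𝓡∂ (m + 1 + 1)) j x v) = ρ (j x) ^ 2 * G.val x v v :=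
    fun x v ↦ hconf x v v
  have hc : IsGeodesicallyComplete G.leviCivita :=
    isGeodesicallyComplete_of_conformallyCompact G h2 hGr Gb hGbr
      (hj.contMDiff.of_le (by simp)) hj.isEmbedding hjr (hρs.of_le (by simp)) hρ0 hρb hconf₁
  -- (3) convexity near infinity
  have hconf₂ : ∀ (x : N) (v w : TangentSpace (𝓡 (m + 1 + 1)) x),
      Gb.val (j x) (mfderiv (𝓡 (m + 1 + 1)) (𝓡∂ (m + 1 + 1)) j x v)
        (mfderiv (𝓡 (m + 1 + 1)) (𝓡∂ (m + 1 + 1)) j x w) = ρ (j x) ^ 2 * G.val x v w :=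
    fun x v w ↦ hconf x v w
  have hν' : ∀ y : B, ∃ ν : TangentSpace (𝓡∂ (m + 1 + 1)) (ι y), Gb.val (ι y) ν ν = 1 ∧
      ∀ a : TangentSpace (𝓡∂ (m + 1 + 1)) (ι y),
        Gb.val (ι y) ν a = mfderiv (𝓡∂ (m + 1 + 1)) 𝓘(ℝ, ℝ) ρ (ι y) a := hν
  obtain ⟨ε₀, hε₀, hconv⟩ :=
    exists_convexity_threshold G Gb hGbr hj hjr hρs hρ0 hρb hconf₂ ι hιr hν'
  -- (4) base point, the function `u = ρ ∘ j`, properness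
  obtain ⟨p⟩ : Nonempty N := inferInstance
  set u : N → ℝ := fun x ↦ ρ (j x) with hu_def
  have hu : ContMDiff (𝓡 (m + 1 + 1)) 𝓘(ℝ, ℝ) ∞ u := hρs.comp hj.contMDiff
  have hje : Topology.IsEmbedding j := hj.isEmbedding
  have hupos : ∀ x : N, 0 < u x := by
    intro x
    have hx : j x ∈ (𝓡∂ (m + 1 + 1)).interior X := hjr ▸ mem_range_self x
    have hnb : j x ∉ (𝓡∂ (m + 1 + 1)).boundary X := fun hb ↦
      Set.disjoint_left.1 ModelWithCorners.disjoint_interior_boundary hx hb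
    exact lt_of_le_of_ne (hρ0 _) fun h0 ↦ hnb ((hρb _).1 h0.symm)
  have hprop : ∀ s : ℝ, 0 < s → IsCompact {x : N | s ≤ u x} := by
    intro s hs
    have hclosed : IsClosed {y : X | s ≤ ρ y} := isClosed_le continuous_const hρs.continuous
    have h := hje.isInducing.isCompact_preimage' hclosed.isCompact (fun y (hy : s ≤ ρ y) ↦ by
      rw [hjr, ← ModelWithCorners.compl_boundary]
      intro hb
      have h0 : ρ y = 0 := (hρb y).2 hb
      linarith)
    exact h
  -- (5) Cartan–Hadamard: `exp_p`
  obtain ⟨hFs, hFloc, hFsurj, hFcov⟩ := exp_covering_of_complete hGr hc hsec' p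
  set F : EuclideanSpace ℝ (Fin (m + 1 + 1)) → N :=
    fun w ↦ expMap G.leviCivita p (show TangentSpace (𝓡 (m + 1 + 1)) p from w) with hFdef
  have hF0 : F 0 = p := expMap_zero (cov := G.leviCivita) p
  -- the boundary is nonempty (otherwise `N` would be compact, contradicting non-trapping)
  have hBne : Nonempty B := by
    by_contra hBe
    rw [not_nonempty_iff] at hBe
    have hbd : (𝓡∂ (m + 1 + 1)).boundary X = ∅ := by
      rw [← hιr, Set.range_eq_empty_iff]; exact hBe
    -- `N` is compact
    have hNc : IsCompact (univ : Set N) := by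
      have h1 : {x : N | u p ≤ u x} ⊆ univ := subset_univ _
      have huniv : (univ : Set N) = j ⁻¹' (univ : Set X) := by simp
      have hXc : IsCompact (univ : Set X) := isCompact_univ
      refine hje.isInducing.isCompact_preimage' hXc ?_ |>.of_isClosed_subset isClosed_univ (by simp)
      intro y _
      rw [hjr, ← ModelWithCorners.compl_boundary, hbd, compl_empty]
      exact mem_univ y
    -- a non-constant geodesic cannot leave the compact `N`
    obtain ⟨c0, hc0, hcv⟩ := exists_pos_mul_norm_sq_le_val_point (g := G) hGr p
    obtain ⟨v₀, hv₀⟩ : ∃ v₀ : EuclideanSpace ℝ (Fin (m + 1 + 1)), v₀ ≠ 0 := exists_ne 0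
    obtain ⟨-, hgeo, h0, hv0⟩ := maximalGeodesic_of_isGeodesicallyComplete hc p
      (show TangentSpace (𝓡 (m + 1 + 1)) p from v₀)
    obtain ⟨T, hT⟩ := hNT _ hgeo (by rw [hv0]; exact hv₀) univ hNc
    exact hT T le_rfl (mem_univ _)
  haveI := hBne
  -- (6) the collar of `∂X` along `ρ`
  set b : BoundaryData (𝓡∂ (m + 1 + 1)) X (𝓡 (m + 1)) :=
    { carrier := B, incl := ι, isSmoothEmbedding := hι, range_incl := hιr } with hb
  have hreg : ∀ z, ρ z = 0 → mfderiv (𝓡∂ (m + 1 + 1)) 𝓘(ℝ, ℝ) ρ z ≠ 0 := by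
    intro z hz h0
    have hzb : z ∈ (𝓡∂ (m + 1 + 1)).boundary X := (hρb z).1 hz
    rw [← hιr] at hzb
    obtain ⟨y, rfl⟩ := hzb
    obtain ⟨ν, hν1, hν2⟩ := hν y
    have h1 := hν2 ν
    rw [h0, hν1] at h1
    have h2 : (1 : ℝ) = 0 := h1
    exact one_ne_zero h2
  obtain ⟨a, c, ha, hcreg, hctop, hcheight⟩ := exists_openCollarData_of_bdf b hρs hρ0 hρb hreg
  -- (7) the level `ε`
  set ε : ℝ := min (min ε₀ (u p)) a / 2 with hε_def
  have hεpos : 0 < ε := by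
    have : 0 < min (min ε₀ (u p)) a := lt_min (lt_min hε₀ (hupos p)) ha
    positivity
  have hεε₀ : ε < ε₀ := by
    have : min (min ε₀ (u p)) a ≤ ε₀ := (min_le_left _ _).trans (min_le_left _ _)
    rw [hε_def]; linarith
  have hεp : ε < u p := by
    have : min (min ε₀ (u p)) a ≤ u p := (min_le_left _ _).trans (min_le_right _ _)
    rw [hε_def]; linarith [hupos p]
  have hεa : ε < a := by
    have : min (min ε₀ (u p)) a ≤ a := min_le_right _ _
    rw [hε_def]; linarith
  -- (8) exit structure of the rays from `p`
  set K : Set (EuclideanSpace ℝ (Fin (m + 1 + 1))) := {w | ε ≤ u (F w)} with hK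
  obtain ⟨U, τ, hUo, hSU, hτd, hstruct, h0K, hstar, ⟨eK⟩⟩ :=
    exit_structure hc hGr hu hNT hprop hconv p hεpos hεε₀ hεp (K := K) hK
  -- (9) `exp_p` is a diffeomorphism
  haveI : LocallyPathConnectedSpace N :=
    ChartedSpace.locallyPathConnectedSpace (EuclideanSpace ℝ (Fin (m + 1 + 1))) N
  haveI : PathConnectedSpace N := pathConnectedSpace_iff_connectedSpace.2 inferInstance
  have hsat : ∀ w, F w ∈ F '' K → w ∈ K := by
    rintro w ⟨w', hw', hww'⟩
    show ε ≤ u (F w)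
    rw [← hww']
    exact hw'
  have hFinj : Injective F := injective_of_star hFcov h0K hstar hsat eK
  set Φ := hFloc.diffeomorphOfBijective ⟨hFinj, hFsurj⟩ with hΦ
  have hΦapp : ∀ w, Φ w = F w := fun w ↦ rfl
  have hΦsymm : ∀ w, Φ.symm (F w) = w := fun w ↦ by
    rw [← hΦapp]; exact Φ.symm_apply_apply w
  have hΦsymm' : ∀ q, F (Φ.symm q) = q := fun q ↦ by
    rw [← hΦapp]; exact Φ.apply_symm_apply q
  -- (10) the `g_p`-norm, normalizations and the radial exit map `R`
  set Bp : EuclideanSpace ℝ (Fin (m + 1 + 1)) →L[ℝ] EuclideanSpace ℝ (Fin (m + 1 + 1)) →L[ℝ] ℝ :=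
    G.val p with hBp
  have hBpos : ∀ w : EuclideanSpace ℝ (Fin (m + 1 + 1)), w ≠ 0 → 0 < Bp w w := fun w hw ↦ hGr p w hw
  have hBnn : ∀ w : EuclideanSpace ℝ (Fin (m + 1 + 1)), 0 ≤ Bp w w := fun w ↦ by
    by_cases hw : w = 0
    · rw [hw]; simp
    · exact (hBpos w hw).le
  set Nm : EuclideanSpace ℝ (Fin (m + 1 + 1)) → ℝ := fun w ↦ Real.sqrt (Bp w w) with hNm
  have hNmpos : ∀ w, w ≠ 0 → 0 < Nm w := fun w hw ↦ Real.sqrt_pos.2 (hBpos w hw)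
  have hNmsq : ∀ w, Nm w ^ 2 = Bp w w := fun w ↦ Real.sq_sqrt (hBnn w)
  have hBsmul : ∀ (r : ℝ) (w : EuclideanSpace ℝ (Fin (m + 1 + 1))), Bp (r • w) (r • w) = r ^ 2 * Bp w w := by
    intro r w
    simp only [map_smul, smul_apply, smul_eq_mul]
    ring
  set nrm : EuclideanSpace ℝ (Fin (m + 1 + 1)) → EuclideanSpace ℝ (Fin (m + 1 + 1)) :=
    fun w ↦ (Nm w)⁻¹ • w with hnrm
  have hnrm_unit : ∀ w, w ≠ 0 → Bp (nrm w) (nrm w) = 1 := by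
    intro w hw
    simp only [hnrm]
    rw [hBsmul, ← hNmsq w, inv_pow]
    exact inv_mul_cancel₀ (pow_ne_zero 2 (hNmpos w hw).ne')
  have hnrm_ne : ∀ w, w ≠ 0 → nrm w ≠ 0 := fun w hw h ↦ by
    have := hnrm_unit w hw; rw [h] at this; simp at this
  have hw_eq : ∀ w, w ≠ 0 → w = Nm w • nrm w := fun w hw ↦ by
    simp only [hnrm]
    rw [smul_smul, mul_inv_cancel₀ (hNmpos w hw).ne', one_smul]
  have hNa : ∀ (r : ℝ) (w : EuclideanSpace ℝ (Fin (m + 1 + 1))), 0 < r → Nm (r • w) = r * Nm w := by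
    intro r w hr
    simp only [hNm]
    rw [hBsmul, Real.sqrt_mul (sq_nonneg r), Real.sqrt_sq hr.le]
  have hnrm_smul : ∀ (r : ℝ) (w : EuclideanSpace ℝ (Fin (m + 1 + 1))), 0 < r → w ≠ 0 →
      nrm (r • w) = nrm w := by
    intro r w hr hw
    simp only [hnrm]
    rw [hNa r w hr, mul_inv, smul_smul, mul_comm (r⁻¹), mul_assoc, inv_mul_cancel₀ hr.ne', mul_one]
  -- Euclidean normalization
  set enrm : EuclideanSpace ℝ (Fin (m + 1 + 1)) → EuclideanSpace ℝ (Fin (m + 1 + 1)) :=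
    fun w ↦ ‖w‖⁻¹ • w with henrm
  have henrm_norm : ∀ w, w ≠ 0 → ‖enrm w‖ = 1 := by
    intro w hw
    simp only [henrm]
    rw [norm_smul, norm_inv, norm_norm, inv_mul_cancel₀ (norm_ne_zero_iff.2 hw)]
  have henrm_smul : ∀ (r : ℝ) (w : EuclideanSpace ℝ (Fin (m + 1 + 1))), 0 < r → w ≠ 0 →
      enrm (r • w) = enrm w := by
    intro r w hr hw
    simp only [henrm]
    rw [norm_smul, Real.norm_eq_abs, abs_of_pos hr, mul_inv, smul_smul, mul_comm (r⁻¹), mul_assoc,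
      inv_mul_cancel₀ hr.ne', mul_one]
  have henrm_id : ∀ w : EuclideanSpace ℝ (Fin (m + 1 + 1)), ‖w‖ = 1 → enrm w = w := by
    intro w hw; simp only [henrm]; rw [hw, inv_one, one_smul]
  have hnrm_enrm : ∀ w, w ≠ 0 → nrm (enrm w) = nrm w := fun w hw ↦
    hnrm_smul _ w (inv_pos.2 (norm_pos_iff.2 hw)) hw
  have henrm_nrm : ∀ w, w ≠ 0 → enrm (nrm w) = enrm w := fun w hw ↦
    henrm_smul _ w (inv_pos.2 (hNmpos w hw)) hw
  -- the radial exit point `R w = τ(v) v`, `v = nrm w`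
  set R : EuclideanSpace ℝ (Fin (m + 1 + 1)) → EuclideanSpace ℝ (Fin (m + 1 + 1)) :=
    fun w ↦ τ (nrm w) • nrm w with hR
  have hR_ne : ∀ w, w ≠ 0 → R w ≠ 0 := fun w hw ↦
    smul_ne_zero (hstruct (nrm w) (hnrm_unit w hw)).1.ne' (hnrm_ne w hw)
  have hR_level : ∀ w, w ≠ 0 → u (F (R w)) = ε := by
    intro w hw
    obtain ⟨-, h2', -, -⟩ := hstruct (nrm w) (hnrm_unit w hw)
    have hFR : F (R w) = maximalGeodesic G.leviCivita p
        (show TangentSpace (𝓡 (m + 1 + 1)) p from nrm w) (τ (nrm w)) := expMap_smul hc p _ _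
    rw [hFR]
    exact h2'
  have hR_smul : ∀ (r : ℝ) (w : EuclideanSpace ℝ (Fin (m + 1 + 1))), 0 < r → w ≠ 0 → R (r • w) = R w := by
    intro r w hr hw; simp only [hR]; rw [hnrm_smul r w hr hw]
  -- a vector whose image lies on the level is its own exit point: `R w = w`
  have hR_of_level : ∀ w, w ≠ 0 → u (F w) = ε → R w = w := by
    intro w hw hlev
    obtain ⟨h1', h2', h3', h4'⟩ := hstruct (nrm w) (hnrm_unit w hw)
    have hFw : F w = maximalGeodesic G.leviCivita p (nrm w) (Nm w) := by
      show expMap G.leviCivita p _ = _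
      conv_lhs => rw [hw_eq w hw]
      exact expMap_smul hc p _ (Nm w)
    rw [hFw] at hlev
    -- `Nm w = τ (nrm w)` since the level is only hit at the exit time
    have hNτ : Nm w = τ (nrm w) := by
      rcases lt_trichotomy (Nm w) (τ (nrm w)) with hlt | heq | hgt
      · exact absurd hlev (h3' _ ⟨(hNmpos w hw).le, hlt⟩).ne'
      · exact heq
      · exact absurd hlev (h4' _ hgt).ne
    simp only [hR]
    rw [← hNτ]
    exact (hw_eq w hw).symm
  -- (11) the maps
  haveI hfact : Fact (Module.finrank ℝ (EuclideanSpace ℝ (Fin (m + 1 + 1))) = m + 1 + 1) :=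
    ⟨finrank_euclideanSpace_fin⟩
  set h₀ : ℝ := ε * (2 / a) with hh₀
  have hh₀mem : h₀ ∈ Ico (0 : ℝ) c.top := by
    rw [hctop]
    refine ⟨by positivity, ?_⟩
    rw [hh₀, mul_div_assoc', div_lt_iff₀ ha]
    linarith
  set kk : B → X := fun y ↦ c.toFun y h₀ with hkk
  have hkρ : ∀ y, ρ (kk y) = ε := by
    intro y
    have h := c.height_apply y h₀ hh₀mem
    rw [hcheight] at h
    have ha0 : a ≠ 0 := ha.ne'
    show ρ (c.toFun y h₀) = ε
    have : ρ (c.toFun y h₀) * (2 / a) = ε * (2 / a) := h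
    field_simp at this
    linarith
  have hk_range : ∀ y, kk y ∈ range j := by
    intro y
    rw [hjr, ← ModelWithCorners.compl_boundary]
    intro hb'
    have := (hρb _).2 hb'
    rw [hkρ] at this
    exact hεpos.ne' this
  set jinv : X → N := Function.invFun j with hjinv
  have hjk : ∀ y, j (jinv (kk y)) = kk y := fun y ↦ Function.invFun_eq (hk_range y)
  have hjinv_j : ∀ q, jinv (j q) = q := Function.leftInverse_invFun hje.injective
  have huk : ∀ y, u (jinv (kk y)) = ε := fun y ↦ by
    show ρ (j (jinv (kk y))) = ε; rw [hjk, hkρ]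
  have hw_ne : ∀ y, Φ.symm (jinv (kk y)) ≠ 0 := by
    intro y h
    have h1 : F (Φ.symm (jinv (kk y))) = jinv (kk y) := hΦsymm' _
    rw [h, hF0] at h1
    have h2 := huk y
    rw [← h1] at h2
    exact absurd h2 hεp.ne'
  -- the maps `Th : sphere → B` and `La : B → sphere`
  have hsph_ne : ∀ (sv : Metric.sphere (0 : EuclideanSpace ℝ (Fin (m + 1 + 1))) 1),
      (sv : EuclideanSpace ℝ (Fin (m + 1 + 1))) ≠ 0 := fun sv ↦ ne_zero_of_mem_unit_sphere sv
  set θ : EuclideanSpace ℝ (Fin (m + 1 + 1)) → B := fun w ↦ c.proj (j (F (R w))) with hθ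
  set Th : Metric.sphere (0 : EuclideanSpace ℝ (Fin (m + 1 + 1))) 1 → B := fun sv ↦ θ sv with hTh_def
  set lam : B → EuclideanSpace ℝ (Fin (m + 1 + 1)) := fun y ↦ enrm (Φ.symm (jinv (kk y))) with hlam
  have hlam_mem : ∀ y, lam y ∈ Metric.sphere (0 : EuclideanSpace ℝ (Fin (m + 1 + 1))) 1 := fun y ↦ by
    rw [mem_sphere_zero_iff_norm]
    exact henrm_norm _ (hw_ne y)
  set La : B → Metric.sphere (0 : EuclideanSpace ℝ (Fin (m + 1 + 1))) 1 :=
    Set.codRestrict lam _ hlam_mem with hLa_def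
  -- the region of the collar contains the level `{ρ = ε}`
  have hregion : ∀ x : X, ρ x = ε → x ∈ c.region := fun x hx ↦ by
    rw [hcreg]; show ρ x < a; rw [hx]; exact hεa
  -- (12) `Th ∘ La = id`
  have hThLa : ∀ y, Th (La y) = y := by
    intro y
    set w := Φ.symm (jinv (kk y)) with hw
    have hw0 : w ≠ 0 := hw_ne y
    have hFw : F w = jinv (kk y) := hΦsymm' _
    have hRw : R (enrm w) = w := by
      rw [show R (enrm w) = R w from hR_smul _ w (inv_pos.2 (norm_pos_iff.2 hw0)) hw0]
      exact hR_of_level w hw0 (by rw [hFw]; exact huk y)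
    show c.proj (j (F (R (enrm w)))) = y
    rw [hRw, hFw, hjk]
    exact c.proj_apply y h₀ hh₀mem
  -- (13) `La ∘ Th = id`
  have hLaTh : ∀ sv, La (Th sv) = sv := by
    intro sv
    have hsv0 := hsph_ne sv
    apply Subtype.ext
    show enrm (Φ.symm (jinv (kk (c.proj (j (F (R sv))))))) = sv
    set x : X := j (F (R sv)) with hx
    have hρx : ρ x = ε := hR_level sv hsv0
    have hkx : kk (c.proj x) = x := by
      show c.toFun (c.proj x) h₀ = x
      have hhx : c.height x = h₀ := by rw [hcheight, hρx]
      rw [← hhx]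
      exact c.apply_proj_height x (hregion x hρx)
    rw [hkx, hx, hjinv_j, hΦsymm]
    show enrm (τ (nrm sv) • nrm sv) = sv
    rw [henrm_smul _ _ (hstruct (nrm sv) (hnrm_unit sv hsv0)).1 (hnrm_ne sv hsv0), henrm_nrm sv hsv0]
    exact henrm_id sv (by simpa only [mem_sphere_zero_iff_norm] using sv.2)
  -- (14) smoothness of `Th`
  have hne_open : IsOpen {w : EuclideanSpace ℝ (Fin (m + 1 + 1)) | w ≠ 0} := isOpen_ne
  have hnrm_d : ContDiffOn ℝ ∞ nrm {w | w ≠ 0} := contDiffOn_formNormalize Bp hBpos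
  have hnrm_maps : MapsTo nrm {w | w ≠ 0} U := fun w hw ↦ hSU (hnrm_unit w hw)
  have hR_d : ContDiffOn ℝ ∞ R {w | w ≠ 0} :=
    ((hτd.comp hnrm_d hnrm_maps).smul hnrm_d)
  have hR_md : ContMDiffOn 𝓘(ℝ, EuclideanSpace ℝ (Fin (m + 1 + 1))) 𝓘(ℝ, EuclideanSpace ℝ (Fin (m + 1 + 1)))
      ∞ R {w | w ≠ 0} := hR_d.contMDiffOn
  have hjF : ContMDiffOn 𝓘(ℝ, EuclideanSpace ℝ (Fin (m + 1 + 1))) (𝓡∂ (m + 1 + 1)) ∞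
      (fun w ↦ j (F (R w))) {w | w ≠ 0} :=
    (hj.contMDiff.comp hFs).comp_contMDiffOn hR_md
  have hθ_d : ContMDiffOn 𝓘(ℝ, EuclideanSpace ℝ (Fin (m + 1 + 1))) (𝓡 (m + 1)) ∞ θ {w | w ≠ 0} :=
    c.contMDiffOn_proj.comp hjF fun w hw ↦ hregion _ (hR_level w hw)
  have hThs : ContMDiff (𝓡 (m + 1)) (𝓡 (m + 1)) ∞ Th :=
    hθ_d.comp_contMDiff contMDiff_coe_sphere fun sv ↦ hsph_ne sv
  -- (15) smoothness of `La`
  have hkk_s : ContMDiff (𝓡 (m + 1)) (𝓡∂ (m + 1 + 1)) ∞ kk :=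
    c.contMDiffOn_toFun.comp_contMDiff (f := fun y : B ↦ (y, h₀))
      (contMDiff_id.prodMk contMDiff_const) fun y ↦ ⟨mem_univ _, hh₀mem⟩
  have hjk_fun : (fun y ↦ j (jinv (kk y))) = kk := funext hjk
  have hik_c : Continuous fun y ↦ jinv (kk y) := by
    rw [hje.isInducing.continuous_iff, Function.comp_def, hjk_fun]
    exact hkk_s.continuous
  have hik_s : ContMDiff (𝓡 (m + 1)) (𝓡 (m + 1 + 1)) ∞ fun y ↦ jinv (kk y) := by
    intro y
    refine (ContMDiffAt.iff_comp_isImmersionAt (hj.isImmersion.isImmersionAt _)).2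
      ⟨hik_c.continuousAt, ?_⟩
    rw [Function.comp_def, hjk_fun]
    exact hkk_s y
  have henrm_d : ContMDiffOn 𝓘(ℝ, EuclideanSpace ℝ (Fin (m + 1 + 1))) 𝓘(ℝ, EuclideanSpace ℝ (Fin (m + 1 + 1)))
      ∞ enrm {w | w ≠ 0} := contDiffOn_normalize.contMDiffOn
  have hlam_s : ContMDiff (𝓡 (m + 1)) 𝓘(ℝ, EuclideanSpace ℝ (Fin (m + 1 + 1))) ∞ lam :=
    henrm_d.comp_contMDiff (Φ.symm.contMDiff.comp hik_s) fun y ↦ hw_ne y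
  have hLas : ContMDiff (𝓡 (m + 1)) (𝓡 (m + 1)) ∞ La := hlam_s.codRestrict_sphere hlam_mem
  -- (16) the diffeomorphism
  refine ⟨⟨⟨La, Th, hThLa, hLaTh⟩, hLas, hThs⟩⟩

end Literature.Geometry.Riemannian

end
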